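import Mathlib
import HarnessLib
import Literature.NumberTheory.Transcendental.KZLogCalculus
import Literature.NumberTheory.Transcendental.KZLogCalculusProofs
import Summits.KontsevichZagierPeriods.KontsevichZagierPeriods.Theses.LiouvilleUnfolding

/-!
# Route LiouvilleUnfolding — item `LogCalculusConservative` (stmt-KontsevichZagierPeriods-2953)

The route statement `LogCalculusConservative` is, by definition, the Literature statement
`Literature.NumberTheory.Transcendental.KZlog.Conservative`:
for every formal KZ representation `c`, if its inclusion `KZlog.incl c` into the syntactic
logarithmic calculus lies in `KZlog.relations` (the subgroup generated by the nine logarithmic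
moves), then `c` already lies in `KZ.relations` (generated by the four algebraic moves).

This is proved in the tree as
`Literature.NumberTheory.Transcendental.KZlog.Conservative_holds`
(`Literature/NumberTheory/Transcendental/KZLogCalculusProofs.lean`): the unfolding
`unfold : KZlog.FormalRep →+ KZ.FormalRep` is a retraction of `incl` on the nose and maps each of
the nine logarithmic moves into `KZ.relations`. The present file only transports that theorem to
the route declaration.
-/

namespace Summit.KontsevichZagierPeriods.LiouvilleUnfolding

/-- **Item `LogCalculusConservative` (stmt-KontsevichZagierPeriods-2953), proved.**
The logarithmic Kontsevich–Zagier calculus `KZlog` is conservative over the four-move calculus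
`KZ`: `KZlog.incl c ∈ KZlog.relations → c ∈ KZ.relations` for every `c : KZ.FormalRep`.
Proof: unfold the route definition and apply the in-tree theorem
`Literature.NumberTheory.Transcendental.KZlog.Conservative_holds`. -/
theorem logCalculusConservative_proof :
    Summit.KontsevichZagierPeriods.KontsevichZagierPeriods.Theses.LiouvilleUnfolding.LogCalculusConservative := by
  unfold Summit.KontsevichZagierPeriods.KontsevichZagierPeriods.Theses.LiouvilleUnfolding.LogCalculusConservative
  exact Literature.NumberTheory.Transcendental.KZlog.Conservative_holds

end Summit.KontsevichZagierPeriods.LiouvilleUnfolding
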